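import Summits.NavierStokesRegularity.FunctionalMining.CrossedShearGradPressureRpow
import Summits.NavierStokesRegularity.FunctionalMining.PidevMomentRateRpow
import HarnessLib

/-!
# FunctionalMining — the crossed shear: Hessians of `cc` and of `G = g_β(x₂) cc`, and their deviators

Search for candidate a priori estimates; no regularity claim. Cell `pub-nsfunc`, prove seat
(gen 11). Calculus for the kernel no-go of the rows `EP.Pidev.q|T_LD|G1` (file `CrossedShearPidevRpow`,
SIEVELD §2 W11): at the reciprocal crossed shear `u_β` the pressure is `π = cc = C(x₀)C(x₁)` and
`Δ⁻¹A = −8π² G`, `G = g_β(x₂) cc` (`CrossedShearPressure`, `CrossedShearPressureRpow`). This file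
tabulates the second partial derivatives of `cc` and `G` (`C = cos 2π·`, `S = sin 2π·`), the
deviatoric Hessian `H = D²_dev cc` (`hessDev`, file `PidevMomentRateRpow`):

`H₀₀ = H₁₁ = −(4/3)π² cc`, `H₂₂ = (8/3)π² cc`, `H₀₁ = H₁₀ = 4π² S(x₀)S(x₁)`, `H₀₂ = H₁₂ = H₂₀ = H₂₁ = 0`,

`|H|² = (32/3)π⁴ cc² + 32π⁴ S(x₀)²S(x₁)²`, and the contraction
`∑ᵢⱼ Hᵢⱼ (D²_dev G)ᵢⱼ = g_β(x₂) |H|² + (8/3)π² g_β″(x₂) cc²`. Pure calculus of explicit fields.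
-/

noncomputable section

open MeasureTheory Set Filter Topology Real
open scoped InnerProductSpace RealInnerProductSpace ContDiff

namespace Summit.NavierStokesRegularity.FunctionalMining

open Literature.Analysis Literature.Analysis.FunctionSpaces Literature.Analysis.FunctionSpaces.Torus
open Literature.Analysis.FluidPDE

namespace CrossedShear

/-! ## 1. Second partial derivatives of `cc` and of `G = g_β(x₂) cc` -/

/-- `∂₀ (P(x₀)Q(x₁)) = P'(x₀)Q(x₁)`. [folklore] -/
theorem partialDeriv_prod₂_zero (P Q : ShearProfile) (x : UnitAddTorus (Fin 3)) :
    Torus.partialDeriv 0 (fun y : UnitAddTorus (Fin 3) => P.onCircle (y 0) * Q.onCircle (y 1)) x =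
      P.D.onCircle (x 0) * Q.onCircle (x 1) := by
  rw [partialDeriv_prod₂]
  have h : ¬ ((0 : Fin 3) = 1) := by decide
  simp only [if_true, h, if_false, mul_zero, add_zero]

/-- `∂₁ (P(x₀)Q(x₁)) = P(x₀)Q'(x₁)`. [folklore] -/
theorem partialDeriv_prod₂_one (P Q : ShearProfile) (x : UnitAddTorus (Fin 3)) :
    Torus.partialDeriv 1 (fun y : UnitAddTorus (Fin 3) => P.onCircle (y 0) * Q.onCircle (y 1)) x =
      P.onCircle (x 0) * Q.D.onCircle (x 1) := by
  rw [partialDeriv_prod₂]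
  have h : ¬ ((1 : Fin 3) = 0) := by decide
  simp only [if_true, h, if_false, zero_mul, zero_add]

/-- `∂₂ (P(x₀)Q(x₁)) = 0`. [folklore] -/
theorem partialDeriv_prod₂_two (P Q : ShearProfile) (x : UnitAddTorus (Fin 3)) :
    Torus.partialDeriv 2 (fun y : UnitAddTorus (Fin 3) => P.onCircle (y 0) * Q.onCircle (y 1)) x = 0 := by
  rw [partialDeriv_prod₂]
  have h1 : ¬ ((2 : Fin 3) = 0) := by decide
  have h2 : ¬ ((2 : Fin 3) = 1) := by decide
  simp only [h1, h2, if_false, zero_mul, mul_zero, add_zero]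

/-- `∂₀cc` as a function: `−2π · S(x₀)C(x₁)`. [folklore] -/
theorem partialDeriv_cc_zero_fun : Torus.partialDeriv 0 cc =
    (-(2 * π)) • fun y : UnitAddTorus (Fin 3) => sinP.onCircle (y 0) * cosP.onCircle (y 1) := by
  funext y; rw [partialDeriv_cc_zero, Pi.smul_apply, smul_eq_mul]; ring

/-- `∂₁cc` as a function: `−2π · C(x₀)S(x₁)`. [folklore] -/
theorem partialDeriv_cc_one_fun : Torus.partialDeriv 1 cc =
    (-(2 * π)) • fun y : UnitAddTorus (Fin 3) => cosP.onCircle (y 0) * sinP.onCircle (y 1) := by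
  funext y; rw [partialDeriv_cc_one, Pi.smul_apply, smul_eq_mul]; ring

/-- `∂₂cc = 0` as a function. [folklore] -/
theorem partialDeriv_cc_two_fun : Torus.partialDeriv 2 cc = fun _ : UnitAddTorus (Fin 3) => (0 : ℝ) := by
  funext y; exact partialDeriv_cc_two y

/-- The `C¹` product `S(x₀)C(x₁)`. [folklore] -/
theorem isContDiff_sc : IsContDiff 1 (fun y : UnitAddTorus (Fin 3) => sinP.onCircle (y 0) * cosP.onCircle (y 1)) :=
  (isSmooth_prod₂ sinP cosP 0 1).isContDiff (by simp)

/-- The `C¹` product `C(x₀)S(x₁)`. [folklore] -/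
theorem isContDiff_cs : IsContDiff 1 (fun y : UnitAddTorus (Fin 3) => cosP.onCircle (y 0) * sinP.onCircle (y 1)) :=
  (isSmooth_prod₂ cosP sinP 0 1).isContDiff (by simp)

/-- **The Hessian of `cc`**: `∂₀∂₀cc = ∂₁∂₁cc = −4π² cc`, `∂₀∂₁cc = ∂₁∂₀cc = 4π² S(x₀)S(x₁)`,
all entries with an index `2` vanish. [folklore] -/
theorem hessian_cc (x : UnitAddTorus (Fin 3)) :
    Torus.partialDeriv 0 (Torus.partialDeriv 0 cc) x = -(4 * π ^ 2) * cc x ∧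
    Torus.partialDeriv 1 (Torus.partialDeriv 0 cc) x = 4 * π ^ 2 * (sinP.onCircle (x 0) * sinP.onCircle (x 1)) ∧
    Torus.partialDeriv 2 (Torus.partialDeriv 0 cc) x = 0 ∧
    Torus.partialDeriv 0 (Torus.partialDeriv 1 cc) x = 4 * π ^ 2 * (sinP.onCircle (x 0) * sinP.onCircle (x 1)) ∧
    Torus.partialDeriv 1 (Torus.partialDeriv 1 cc) x = -(4 * π ^ 2) * cc x ∧
    Torus.partialDeriv 2 (Torus.partialDeriv 1 cc) x = 0 ∧
    Torus.partialDeriv 0 (Torus.partialDeriv 2 cc) x = 0 ∧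
    Torus.partialDeriv 1 (Torus.partialDeriv 2 cc) x = 0 ∧
    Torus.partialDeriv 2 (Torus.partialDeriv 2 cc) x = 0 := by
  have hz : ∀ r : Fin 3, Torus.partialDeriv r (fun _ : UnitAddTorus (Fin 3) => (0 : ℝ)) x = 0 := by
    intro r; simp [Torus.partialDeriv, Torus.lineDeriv]
  refine ⟨?_, ?_, ?_, ?_, ?_, ?_, ?_, ?_, ?_⟩
  · rw [partialDeriv_cc_zero_fun, Torus.partialDeriv_const_smul isContDiff_sc, Pi.smul_apply, smul_eq_mul,
      partialDeriv_prod₂_zero, sinP_D_onCircle, cc]; ring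
  · rw [partialDeriv_cc_zero_fun, Torus.partialDeriv_const_smul isContDiff_sc, Pi.smul_apply, smul_eq_mul,
      partialDeriv_prod₂_one, cosP_D_onCircle]; ring
  · rw [partialDeriv_cc_zero_fun, Torus.partialDeriv_const_smul isContDiff_sc, Pi.smul_apply, smul_eq_mul,
      partialDeriv_prod₂_two, mul_zero]
  · rw [partialDeriv_cc_one_fun, Torus.partialDeriv_const_smul isContDiff_cs, Pi.smul_apply, smul_eq_mul,
      partialDeriv_prod₂_zero, cosP_D_onCircle]; ring
  · rw [partialDeriv_cc_one_fun, Torus.partialDeriv_const_smul isContDiff_cs, Pi.smul_apply, smul_eq_mul,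
      partialDeriv_prod₂_one, sinP_D_onCircle, cc]; ring
  · rw [partialDeriv_cc_one_fun, Torus.partialDeriv_const_smul isContDiff_cs, Pi.smul_apply, smul_eq_mul,
      partialDeriv_prod₂_two, mul_zero]
  · rw [partialDeriv_cc_two_fun, hz]
  · rw [partialDeriv_cc_two_fun, hz]
  · rw [partialDeriv_cc_two_fun, hz]

/-- **The deviatoric Hessian `H = D²_dev cc`**, all nine entries. [ours; elementary] -/
theorem hessDev_cc (x : UnitAddTorus (Fin 3)) :
    hessDev cc 0 0 x = -(4 / 3 * π ^ 2) * cc x ∧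
    hessDev cc 0 1 x = 4 * π ^ 2 * (sinP.onCircle (x 0) * sinP.onCircle (x 1)) ∧
    hessDev cc 0 2 x = 0 ∧
    hessDev cc 1 0 x = 4 * π ^ 2 * (sinP.onCircle (x 0) * sinP.onCircle (x 1)) ∧
    hessDev cc 1 1 x = -(4 / 3 * π ^ 2) * cc x ∧
    hessDev cc 1 2 x = 0 ∧
    hessDev cc 2 0 x = 0 ∧
    hessDev cc 2 1 x = 0 ∧
    hessDev cc 2 2 x = 8 / 3 * π ^ 2 * cc x := by
  obtain ⟨h00, h10, h20, h01, h11, h21, h02, h12, h22⟩ := hessian_cc x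
  have h3 : (Fintype.card (Fin 3) : ℝ) = 3 := by simp
  simp only [hessDev, Fin.sum_univ_three, h00, h10, h20, h01, h11, h21, h02, h12, h22, h3]
  refine ⟨?_, ?_, ?_, ?_, ?_, ?_, ?_, ?_, ?_⟩ <;> simp <;> ring

/-- **`|H|² = ∑ᵢⱼ (D²_dev cc)ᵢⱼ² = (32/3)π⁴ cc² + 32π⁴ S(x₀)²S(x₁)²`.** [ours; elementary] -/
theorem sum_hessDev_cc_sq (x : UnitAddTorus (Fin 3)) :
    ∑ i, ∑ j, hessDev cc i j x ^ 2 =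
      32 / 3 * π ^ 4 * cc x ^ 2 + 32 * π ^ 4 * (sinP.onCircle (x 0) * sinP.onCircle (x 1)) ^ 2 := by
  obtain ⟨h00, h01, h02, h10, h11, h12, h20, h21, h22⟩ := hessDev_cc x
  simp only [Fin.sum_univ_three, h00, h01, h02, h10, h11, h12, h20, h21, h22]
  ring

/-- `|H|²` does not see `x₂`. [folklore] -/
theorem sum_hessDev_cc_sq_add_single_two (x : UnitAddTorus (Fin 3)) (c : UnitAddCircle) :
    ∑ i, ∑ j, hessDev cc i j (x + Pi.single 2 c) ^ 2 = ∑ i, ∑ j, hessDev cc i j x ^ 2 := by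
  have h0 : (x + Pi.single (2 : Fin 3) c : UnitAddTorus (Fin 3)) 0 = x 0 := by simp
  have h1 : (x + Pi.single (2 : Fin 3) c : UnitAddTorus (Fin 3)) 1 = x 1 := by simp
  have hc : cc (x + Pi.single (2 : Fin 3) c) = cc x := by rw [cc, cc, h0, h1]
  rw [sum_hessDev_cc_sq, sum_hessDev_cc_sq, hc, h0, h1]

/-- `∂₀G` as a function: `−2π · g_β(x₂) S(x₀)C(x₁)`. [folklore] -/
theorem partialDeriv_Gfun_zero_fun (β : ℝ) : Torus.partialDeriv 0 (Gfun β) =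
    (-(2 * π)) • fun y : UnitAddTorus (Fin 3) =>
      (gP β).onCircle (y 2) * (sinP.onCircle (y 0) * cosP.onCircle (y 1)) := by
  funext y; rw [partialDeriv_Gfun_zero, partialDeriv_cc_zero, Pi.smul_apply, smul_eq_mul]; ring

/-- `∂₁G` as a function: `−2π · g_β(x₂) C(x₀)S(x₁)`. [folklore] -/
theorem partialDeriv_Gfun_one_fun (β : ℝ) : Torus.partialDeriv 1 (Gfun β) =
    (-(2 * π)) • fun y : UnitAddTorus (Fin 3) =>
      (gP β).onCircle (y 2) * (cosP.onCircle (y 0) * sinP.onCircle (y 1)) := by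
  funext y; rw [partialDeriv_Gfun_one, partialDeriv_cc_one, Pi.smul_apply, smul_eq_mul]; ring

/-- `∂₂G` as a function: `g_β'(x₂) C(x₀)C(x₁)`. [folklore] -/
theorem partialDeriv_Gfun_two_fun (β : ℝ) : Torus.partialDeriv 2 (Gfun β) =
    fun y : UnitAddTorus (Fin 3) => (gP β).D.onCircle (y 2) * (cosP.onCircle (y 0) * cosP.onCircle (y 1)) := by
  funext y; rw [partialDeriv_Gfun_two, cc]

/-- A product `P(x₂)Q(x₀)R(x₁)` is `C¹`. [folklore] -/
theorem isContDiff_prod₃ (P Q R : ShearProfile) :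
    IsContDiff 1 (fun y : UnitAddTorus (Fin 3) => P.onCircle (y 2) * (Q.onCircle (y 0) * R.onCircle (y 1))) :=
  (isContDiff_onCircle_comp' P 2).mul ((isSmooth_prod₂ Q R 0 1).isContDiff (by simp))

/-- **The Hessian of `G = g_β(x₂) cc`** (`g = g_β(x₂)`, `g′`, `g″` its derivatives):
`∂₀∂₀G = ∂₁∂₁G = −4π² g cc`, `∂₁∂₀G = ∂₀∂₁G = 4π² g S(x₀)S(x₁)`, `∂₂∂₀G = ∂₀∂₂G = −2π g′ S(x₀)C(x₁)`,
`∂₂∂₁G = ∂₁∂₂G = −2π g′ C(x₀)S(x₁)`, `∂₂∂₂G = g″ cc`. [folklore] -/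
theorem hessian_Gfun (β : ℝ) (x : UnitAddTorus (Fin 3)) :
    Torus.partialDeriv 0 (Torus.partialDeriv 0 (Gfun β)) x = -(4 * π ^ 2) * (gP β).onCircle (x 2) * cc x ∧
    Torus.partialDeriv 1 (Torus.partialDeriv 0 (Gfun β)) x =
      4 * π ^ 2 * (gP β).onCircle (x 2) * (sinP.onCircle (x 0) * sinP.onCircle (x 1)) ∧
    Torus.partialDeriv 2 (Torus.partialDeriv 0 (Gfun β)) x =
      -(2 * π) * (gP β).D.onCircle (x 2) * (sinP.onCircle (x 0) * cosP.onCircle (x 1)) ∧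
    Torus.partialDeriv 0 (Torus.partialDeriv 1 (Gfun β)) x =
      4 * π ^ 2 * (gP β).onCircle (x 2) * (sinP.onCircle (x 0) * sinP.onCircle (x 1)) ∧
    Torus.partialDeriv 1 (Torus.partialDeriv 1 (Gfun β)) x = -(4 * π ^ 2) * (gP β).onCircle (x 2) * cc x ∧
    Torus.partialDeriv 2 (Torus.partialDeriv 1 (Gfun β)) x =
      -(2 * π) * (gP β).D.onCircle (x 2) * (cosP.onCircle (x 0) * sinP.onCircle (x 1)) ∧
    Torus.partialDeriv 0 (Torus.partialDeriv 2 (Gfun β)) x =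
      -(2 * π) * (gP β).D.onCircle (x 2) * (sinP.onCircle (x 0) * cosP.onCircle (x 1)) ∧
    Torus.partialDeriv 1 (Torus.partialDeriv 2 (Gfun β)) x =
      -(2 * π) * (gP β).D.onCircle (x 2) * (cosP.onCircle (x 0) * sinP.onCircle (x 1)) ∧
    Torus.partialDeriv 2 (Torus.partialDeriv 2 (Gfun β)) x = (gP β).D.D.onCircle (x 2) * cc x := by
  refine ⟨?_, ?_, ?_, ?_, ?_, ?_, ?_, ?_, ?_⟩
  · rw [partialDeriv_Gfun_zero_fun, Torus.partialDeriv_const_smul (isContDiff_prod₃ _ _ _), Pi.smul_apply,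
      smul_eq_mul, partialDeriv_zero_prod₃, sinP_D_onCircle, cc]; ring
  · rw [partialDeriv_Gfun_zero_fun, Torus.partialDeriv_const_smul (isContDiff_prod₃ _ _ _), Pi.smul_apply,
      smul_eq_mul, partialDeriv_one_prod₃, cosP_D_onCircle]; ring
  · rw [partialDeriv_Gfun_zero_fun, Torus.partialDeriv_const_smul (isContDiff_prod₃ _ _ _), Pi.smul_apply,
      smul_eq_mul, partialDeriv_two_prod₃]; ring
  · rw [partialDeriv_Gfun_one_fun, Torus.partialDeriv_const_smul (isContDiff_prod₃ _ _ _), Pi.smul_apply,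
      smul_eq_mul, partialDeriv_zero_prod₃, cosP_D_onCircle]; ring
  · rw [partialDeriv_Gfun_one_fun, Torus.partialDeriv_const_smul (isContDiff_prod₃ _ _ _), Pi.smul_apply,
      smul_eq_mul, partialDeriv_one_prod₃, sinP_D_onCircle, cc]; ring
  · rw [partialDeriv_Gfun_one_fun, Torus.partialDeriv_const_smul (isContDiff_prod₃ _ _ _), Pi.smul_apply,
      smul_eq_mul, partialDeriv_two_prod₃]; ring
  · rw [partialDeriv_Gfun_two_fun, partialDeriv_zero_prod₃, cosP_D_onCircle]; ring
  · rw [partialDeriv_Gfun_two_fun, partialDeriv_one_prod₃, cosP_D_onCircle]; ring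
  · rw [partialDeriv_Gfun_two_fun, partialDeriv_two_prod₃, cc]

/-- **`∑ᵢⱼ Hᵢⱼ (D²_dev G)ᵢⱼ = g_β(x₂) |H|² + (8/3)π² g_β″(x₂) cc²`** (`H = D²_dev cc`, `G = g_β(x₂) cc`).
[ours; elementary] -/
theorem sum_hessDev_cc_mul_hessDev_Gfun (β : ℝ) (x : UnitAddTorus (Fin 3)) :
    ∑ i, ∑ j, hessDev cc i j x * hessDev (Gfun β) i j x =
      (gP β).onCircle (x 2) * ∑ i, ∑ j, hessDev cc i j x ^ 2 +
        8 / 3 * π ^ 2 * (gP β).D.D.onCircle (x 2) * cc x ^ 2 := by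
  obtain ⟨h00, h01, h02, h10, h11, h12, h20, h21, h22⟩ := hessDev_cc x
  obtain ⟨g00, g10, g20, g01, g11, g21, g02, g12, g22⟩ := hessian_Gfun β x
  simp only [Fin.sum_univ_three, h00, h01, h02, h10, h11, h12, h20, h21, h22]
  have h3 : (Fintype.card (Fin 3) : ℝ) = 3 := by simp
  simp only [hessDev, Fin.sum_univ_three, g00, g10, g20, g01, g11, g21, g02, g12, g22, h3]
  simp
  ring

end CrossedShear

end Summit.NavierStokesRegularity.FunctionalMining
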